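import Literature.Analysis.FunctionSpaces.TorusFourierCalculus
import Literature.Analysis.FluidPDE.AlexakisDoeringProofs
import Literature.Analysis.FluidPDE.NashRankOneDecomposition
import HarnessLib

/-!
# The Mikado-flow vector potentials of Coiculescu–Palasek: `Ψ = N⁻² φ̃(Mx) sin(N(x-x₀)·η) θ` is a
# smooth steady pressureless Euler flow (Def. 3.1, Lemma 3.2)

Analysis/FluidPDE support file (definitions with proved API; no named facts) on the discharge path
of the named fact `Literature.Barriers.NavierStokesRegularity.CoiculescuPalasek2025_principalParts`
(`Barriers/NavierStokesRegularity/CriticalDataSmoothNonuniquenessConstruction.lean`). The principal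
parts of M. P. Coiculescu, S. Palasek, *Non-uniqueness of smooth solutions of the Navier–Stokes
equations from critical data*, Invent. Math. 244 (2025), arXiv:2503.14699, are built (Def. 3.5,
Def. 3.10) from the **Mikado flow vector potentials** of their Def. 3.1,

  `Ψ⁰_{j,k}(x) = N_k⁻² φ̃_j(M_k x) sin(N_k (x - x_j)·η_j) θ_j`,   `Ψ_{j,k}(x,t) = Ψ⁰_{j,k}(x) e^{-|η_j|²N_k²t}`,

where `θ_j ∈ ℤ³` are the six directions of the Nash lemma (`CP25.nashDir`), `η_j ∈ ℤ³ ∖ 0` with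
`θ_j · η_j = 0` (`CP25.nashNormal`, `CP25.nashDir_dot_nashNormal`), and `φ̃_j` is a smooth pipe
profile around the periodic line `ℓ_j = x_j + θ_j ℝ`, hence constant along `θ_j`. **Lemma 3.2**
(items 1–2): `Ψ⁰_{j,k}` and `Ψ_{j,k}(t)` are smooth, `2π`-periodic, obey
`‖∇^m Ψ⁰_{j,k}‖_∞ ≲_m N_k^{-2+m}`, and "solve the steady pressureless Euler equations:
`div(Ψ_{j,k} ⊗ Ψ_{j,k}) = 0`, `div Ψ_{j,k} = 0`" — "elementary consequences of Definition 3.1".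

This file vendors the potential, transported to the unit torus `(ℝ/ℤ)^d` (the paper's
`𝕋³ = (ℝ/2πℤ)³` under `x ↦ 2πx`: integer frequencies act through the characters
`e_k(x) = exp(2πi k·x)` of Mathlib's `UnitAddTorus.mFourier`), in the ABSTRACT form in which
Lemma 3.2 (2) holds — any integer direction `θ`, any integer frequency vector `k` with `θ · k = 0`
(in the paper `k = N_k η_j`), any complex amplitude `Λ` (the phase `sin(N(x - x_j)·η)` is
`Re(Λ e_{Nη}(x))` with `Λ = -i e_{Nη}(-x_j)`), and any smooth scalar cutoff `g` that is constant
along `θ` (`(θ·∇)g = 0`; in the paper `g = φ̃_j`, rescaled by `M_k`):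

* `CP25.dirVec θ` — the integer vector `θ` in `ℝ^d`; `CP25.shearPhase k Λ x = Re(Λ e_k(x))`;
  `CP25.mikadoAmp k Λ g M N x = N⁻² g(M • x) Re(Λ e_k(x))` (the scalar amplitude) and
  `CP25.mikadoPotential θ k Λ g M N x = mikadoAmp … x • dirVec θ` (Def. 3.1);
* smoothness: `CP25.isSmooth_shearPhase`, `CP25.isSmooth_mikadoAmp`, `CP25.isSmooth_mikadoPotential`;
* the derivative of the phase, `∂ⱼ Re(Λ e_k) = Re(2πi kⱼ Λ e_k)` (`CP25.partialDeriv_shearPhase`), and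
  the two invariances along `θ`: `(θ·∇) Re(Λ e_k) = 0` when `θ · k = 0`
  (`CP25.sum_mul_partialDeriv_shearPhase_eq_zero`) and `(θ·∇)(g(M•·)) = 0` when `(θ·∇)g = 0`
  (`CP25.sum_mul_partialDeriv_comp_nsmul_eq_zero`), whence `(θ·∇) mikadoAmp = 0`
  (`CP25.sum_mul_partialDeriv_mikadoAmp_eq_zero`);
* **Lemma 3.2 (2)**: `div Ψ = 0` (`CP25.isDivFree_mikadoPotential`) and `(Ψ·∇)Ψ = 0`
  (`CP25.convect_mikadoPotential_self`), i.e. `Ψ` is a steady solution of the pressureless Euler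
  equations (`div(Ψ ⊗ Ψ) = (Ψ·∇)Ψ + (div Ψ)Ψ = 0`);
* the size bound `‖Ψ(x)‖ ≤ N⁻² ‖Λ‖ |g(M•x)| ‖θ‖` (`CP25.norm_mikadoPotential_le`; Lemma 3.2 (1),
  `m = 0`);
* the instance for the paper's directions: `θ = θ_j`, `k = N • η_j`
  (`CP25.isDivFree_mikadoPotential_nash`, `CP25.convect_mikadoPotential_nash_self`).

The time-dependent potential `Ψ(t) = e^{-4π²|k|²t} Ψ⁰` is the constant multiple
`mikadoPotential θ k (e^{-4π²|k|²t} Λ) g M N`, so every statement here applies to it verbatim. The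
higher derivative bounds `‖∇^mΨ⁰‖_∞ ≲_m N^{-2+m}` (Lemma 3.2 (1), `m ≥ 1`), the pipe profiles
`φ̃_j` themselves (item 3: supports, separation) and `A_{j,k} ∼ δ` (item 4) are not in this file.

## Mathlib / tree search

Reused: `Torus.partialDeriv/divergence/convect/IsDivFree/IsSmooth` (`TorusCalculus`),
`partialDeriv_mul`, `fderiv_smul_apply`, `fderiv_apply_eq_sum_partialDeriv`,
`hasDerivAt_comp_add_proj_smul`, `partialDeriv_eq_fderiv_apply` (`TorusCalculusProofs`),
`partialDeriv_mFourier`, `isSmooth_mFourier` (`TorusFourierCalculus`, `FlatTorus`),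
`isSmooth_comp_nsmul`, `partialDeriv_comp_nsmul` (`AlexakisDoeringProofs`), `CP25.nashDir`,
`CP25.nashNormal`, `CP25.nashDir_dot_nashNormal` (`NashRankOneDecomposition`). The tree's other
Mikado tool-kit (`MikadoFlows`, `MikadoRescaled`, `TransversePullback`: Cheskidov–Luo profiles
`ψ_k e_k` pulled back along orthogonal integer forms) has no oscillating phase and serves the
directions `e_i, e_i ± 2e_j`; nothing there is redefined (`lean search 'mikadoPotential|shearPhase'`:
no prior declarations).

## References

* M. P. Coiculescu, S. Palasek, Invent. Math. 244 (2025) 165–219, doi:10.1007/s00222-025-01396-z,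
  arXiv:2503.14699: §3.1, Def. 3.1 and Lemma 3.2 (1)–(2), App. A Lemma A.1 (the `θ_j`, `η_j`).
  [CoiculescuPalasek2025]
* S. Daneri, L. Székelyhidi Jr., Arch. Ration. Mech. Anal. 224 (2017) 471–514, Lemma 2.3 (Mikado
  flows). [DaneriSzekelyhidi2017]
-/

noncomputable section

open MeasureTheory Set Filter UnitAddTorus
open scoped BigOperators

namespace Literature.Analysis.FluidPDE

namespace CP25

open Literature.Analysis.FunctionSpaces Literature.Analysis.FunctionSpaces.Torus

variable {d : Type*} [Fintype d] [DecidableEq d]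

/-! ## The objects -/

/-- An integer vector `θ ∈ ℤ^d` regarded as a vector of `ℝ^d` (the directions `θ_j` and normals
`η_j` of §3.1). [cite: CoiculescuPalasek2025, §3.1] -/
def dirVec (θ : d → ℤ) : EuclideanSpace ℝ d := WithLp.toLp 2 fun i => (θ i : ℝ)

omit [Fintype d] [DecidableEq d] in
/-- Coordinates of `dirVec θ`. [folklore] -/
@[simp]
theorem dirVec_apply (θ : d → ℤ) (i : d) : dirVec θ i = θ i := rfl

/-- **The oscillating shear phase** `Re(Λ e_k(x))`, `e_k(x) = exp(2πi k·x)` (Mathlib's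
`UnitAddTorus.mFourier`): for `Λ = -i e_k(-x₀)` this is `sin(2π k·(x - x₀))`, the factor
`sin(N_k(x - x_j)·η_j)` of Def. 3.1 with `k = N_k η_j` after transport to the unit torus.
[cite: CoiculescuPalasek2025, Def. 3.1] -/
def shearPhase (k : d → ℤ) (Λ : ℂ) (x : UnitAddTorus d) : ℝ := (Λ * mFourier k x).re

/-- **The scalar amplitude of the Mikado potential**: `N⁻² g(M • x) Re(Λ e_k(x))` (Def. 3.1:
`N_k⁻² φ̃_j(M_k x) sin(N_k(x - x_j)·η_j)`, with the pipe profile `g = φ̃_j`).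
[cite: CoiculescuPalasek2025, Def. 3.1] -/
def mikadoAmp (k : d → ℤ) (Λ : ℂ) (g : UnitAddTorus d → ℝ) (M N : ℕ) (x : UnitAddTorus d) : ℝ :=
  ((N : ℝ) ^ 2)⁻¹ * (g (M • x) * shearPhase k Λ x)

/-- **The Mikado flow vector potential** (Coiculescu–Palasek, Def. 3.1, transported to the unit
torus and abstracted in the profile): `Ψ(x) = N⁻² g(M • x) Re(Λ e_k(x)) θ`, a shear-type field
pointing in the fixed integer direction `θ`. [cite: CoiculescuPalasek2025, Def. 3.1] -/
def mikadoPotential (θ k : d → ℤ) (Λ : ℂ) (g : UnitAddTorus d → ℝ) (M N : ℕ) (x : UnitAddTorus d) :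
    EuclideanSpace ℝ d :=
  mikadoAmp k Λ g M N x • dirVec θ

omit [DecidableEq d] in
/-- `Ψ(x) = (amplitude) • θ`. [folklore] -/
theorem mikadoPotential_apply (θ k : d → ℤ) (Λ : ℂ) (g : UnitAddTorus d → ℝ) (M N : ℕ)
    (x : UnitAddTorus d) : mikadoPotential θ k Λ g M N x = mikadoAmp k Λ g M N x • dirVec θ := rfl

/-! ## Smoothness -/

omit [DecidableEq d] in
/-- The phase `Re(Λ e_k)` is smooth. [folklore] -/
theorem isSmooth_shearPhase (k : d → ℤ) (Λ : ℂ) : Torus.IsSmooth (shearPhase (d := d) k Λ) := by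
  have h1 : Torus.IsSmooth (fun x : UnitAddTorus d => Λ * mFourier k x) := by
    have h := isSmooth_mFourier (d := d) k
    unfold Torus.IsSmooth at h ⊢
    exact contDiff_const.mul h
  exact h1.comp_clm Complex.reCLM

omit [DecidableEq d] in
/-- The amplitude is smooth for smooth `g`. [folklore] -/
theorem isSmooth_mikadoAmp (k : d → ℤ) (Λ : ℂ) {g : UnitAddTorus d → ℝ} (hg : Torus.IsSmooth g)
    (M N : ℕ) : Torus.IsSmooth (mikadoAmp (d := d) k Λ g M N) := by
  have h1 : Torus.IsSmooth (fun x : UnitAddTorus d => g (M • x) * shearPhase k Λ x) :=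
    (isSmooth_comp_nsmul hg M).smul' (isSmooth_shearPhase k Λ)
  exact h1.smul (((N : ℝ) ^ 2)⁻¹)

omit [DecidableEq d] in
/-- **Lemma 3.2 (1), smoothness**: the Mikado potential is smooth for a smooth profile.
[cite: CoiculescuPalasek2025, Lemma 3.2 (1)] -/
theorem isSmooth_mikadoPotential (θ k : d → ℤ) (Λ : ℂ) {g : UnitAddTorus d → ℝ} (hg : Torus.IsSmooth g)
    (M N : ℕ) : Torus.IsSmooth (mikadoPotential (d := d) θ k Λ g M N) :=
  (isSmooth_mikadoAmp k Λ hg M N).smul' (isSmooth_const _)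

/-! ## Elementary calculus on the torus: constants and constant multiples -/

section Calculus

variable {F : Type*} [NormedAddCommGroup F] [NormedSpace ℝ F]

omit [Fintype d] in
/-- `∂ᵢ (c f) = c ∂ᵢ f` for a real constant `c` and `f` real-valued. [folklore] -/
theorem partialDeriv_const_mul (c : ℝ) (f : UnitAddTorus d → ℝ) (i : d) (x : UnitAddTorus d) :
    Torus.partialDeriv i (fun y => c * f y) x = c * Torus.partialDeriv i f x := by
  simp only [Torus.partialDeriv, Torus.lineDeriv]
  exact congrFun (deriv_const_mul_field' c) 0

omit [Fintype d] in
/-- `∂ᵢ (f c) = (∂ᵢ f) c` for a real constant `c` and `f` real-valued. [folklore] -/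
theorem partialDeriv_mul_const (f : UnitAddTorus d → ℝ) (c : ℝ) (i : d) (x : UnitAddTorus d) :
    Torus.partialDeriv i (fun y => f y * c) x = Torus.partialDeriv i f x * c := by
  simp only [Torus.partialDeriv, Torus.lineDeriv]
  exact congrFun (deriv_mul_const_field' c) 0

omit [Fintype d] [DecidableEq d] in
/-- The torus derivative of a constant field vanishes. [folklore] -/
theorem fderiv_const_apply (c : F) (x : UnitAddTorus d) (w : EuclideanSpace ℝ d) :
    Torus.fderiv (fun _ : UnitAddTorus d => c) x w = 0 := by
  have h : liftAt (fun _ : UnitAddTorus d => c) x = fun _ => c := rfl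
  rw [Torus.fderiv, h]
  simp

end Calculus

/-! ## The derivative of the phase and the invariances along `θ` -/

omit [DecidableEq d] in
/-- Along the coordinate line in direction `eⱼ` the character has derivative
`t ↦ Λ e_k(x + t eⱼ)` ↦ `Λ · 2πi kⱼ e_k(x)` at `t = 0`. [folklore] -/
theorem hasDerivAt_const_mul_mFourier_line [DecidableEq d] (k : d → ℤ) (Λ : ℂ) (j : d)
    (x : UnitAddTorus d) :
    HasDerivAt (fun t : ℝ => Λ * mFourier k (x + Torus.proj (t • EuclideanSpace.single j (1 : ℝ))))
      (Λ * (2 * Real.pi * Complex.I * (k j) * mFourier k x)) 0 := by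
  have hC1 : IsContDiff 1 (⇑(mFourier k) : UnitAddTorus d → ℂ) :=
    (isSmooth_mFourier k).isContDiff (by exact_mod_cast le_top)
  have h := hasDerivAt_comp_add_proj_smul hC1 x (EuclideanSpace.single j (1 : ℝ)) 0
  simp only [zero_smul, Torus.proj_zero, add_zero] at h
  have h2 : Torus.lineDeriv (⇑(mFourier k)) x (EuclideanSpace.single j 1) =
      2 * Real.pi * Complex.I * (k j) * mFourier k x := partialDeriv_mFourier k j x
  rw [h2] at h
  exact h.const_mul Λ

/-- **Derivative of the phase**: `∂ⱼ Re(Λ e_k)(x) = Re(Λ · 2πi kⱼ e_k(x))`.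
[cite: CoiculescuPalasek2025, Lemma 3.2 (proof, "elementary consequences of Definition 3.1")] -/
theorem partialDeriv_shearPhase (k : d → ℤ) (Λ : ℂ) (j : d) (x : UnitAddTorus d) :
    Torus.partialDeriv j (shearPhase k Λ) x = (Λ * (2 * Real.pi * Complex.I * (k j) * mFourier k x)).re := by
  have h := hasDerivAt_const_mul_mFourier_line k Λ j x
  have h2 := (Complex.reCLM.hasFDerivAt.comp_hasDerivAt (0 : ℝ) h)
  simp only [Torus.partialDeriv, Torus.lineDeriv, shearPhase]
  exact h2.deriv

/-- **The phase is constant along `θ` when `θ · k = 0`**: `∑ᵢ θᵢ ∂ᵢ Re(Λ e_k) = Re(2πi (θ·k) Λ e_k) = 0`.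
[cite: CoiculescuPalasek2025, §3.1 (`θ_j · η_j = 0`) and Lemma 3.2 (2)] -/
theorem sum_mul_partialDeriv_shearPhase_eq_zero {θ k : d → ℤ} (hθk : ∑ i, θ i * k i = 0) (Λ : ℂ)
    (x : UnitAddTorus d) : ∑ i, (θ i : ℝ) * Torus.partialDeriv i (shearPhase k Λ) x = 0 := by
  simp_rw [partialDeriv_shearPhase]
  have h : ∀ i, (θ i : ℝ) * (Λ * (2 * Real.pi * Complex.I * (k i) * mFourier k x)).re =
      (((θ i : ℝ) : ℂ) * (Λ * (2 * Real.pi * Complex.I * (k i) * mFourier k x))).re := by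
    intro i
    rw [Complex.re_ofReal_mul]
  simp_rw [h]
  rw [← Complex.re_sum]
  have hsum : ∑ i, ((θ i : ℝ) : ℂ) * (Λ * (2 * Real.pi * Complex.I * (k i) * mFourier k x)) =
      (Λ * (2 * Real.pi * Complex.I) * mFourier k x) * ∑ i, ((θ i : ℝ) : ℂ) * (k i : ℂ) := by
    rw [Finset.mul_sum]
    refine Finset.sum_congr rfl fun i _ => ?_
    ring
  have hzero : ∑ i, ((θ i : ℝ) : ℂ) * (k i : ℂ) = 0 := by
    have h1 : ∑ i, ((θ i : ℝ) : ℂ) * (k i : ℂ) = ((∑ i, θ i * k i : ℤ) : ℂ) := by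
      push_cast
      rfl
    rw [h1, hθk]
    simp
  rw [hsum, hzero, mul_zero, Complex.zero_re]

/-- **A rescaled `θ`-invariant profile is `θ`-invariant**: if `∑ᵢ θᵢ ∂ᵢ g ≡ 0` then
`∑ᵢ θᵢ ∂ᵢ (g(M • ·)) ≡ 0` (`∂ᵢ(g(M•·))(x) = M (∂ᵢg)(M•x)`). [folklore] -/
theorem sum_mul_partialDeriv_comp_nsmul_eq_zero {θ : d → ℤ} {g : UnitAddTorus d → ℝ}
    (hθg : ∀ x, ∑ i, (θ i : ℝ) * Torus.partialDeriv i g x = 0) (M : ℕ) (x : UnitAddTorus d) :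
    ∑ i, (θ i : ℝ) * Torus.partialDeriv i (fun y => g (M • y)) x = 0 := by
  simp_rw [partialDeriv_comp_nsmul g M, smul_eq_mul]
  have h : ∑ i, (θ i : ℝ) * ((M : ℝ) * Torus.partialDeriv i g (M • x)) =
      (M : ℝ) * ∑ i, (θ i : ℝ) * Torus.partialDeriv i g (M • x) := by
    rw [Finset.mul_sum]
    refine Finset.sum_congr rfl fun i _ => ?_
    ring
  rw [h, hθg, mul_zero]

/-- **The amplitude is constant along `θ`**: with `θ · k = 0` and `(θ·∇)g = 0`,
`∑ᵢ θᵢ ∂ᵢ (N⁻² g(M•·) Re(Λ e_k)) ≡ 0` (Leibniz rule and the two invariances).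
[cite: CoiculescuPalasek2025, Lemma 3.2 (2) (proof)] -/
theorem sum_mul_partialDeriv_mikadoAmp_eq_zero {θ k : d → ℤ} (hθk : ∑ i, θ i * k i = 0) (Λ : ℂ)
    {g : UnitAddTorus d → ℝ} (hg : Torus.IsSmooth g) (hθg : ∀ x, ∑ i, (θ i : ℝ) * Torus.partialDeriv i g x = 0)
    (M N : ℕ) (x : UnitAddTorus d) :
    ∑ i, (θ i : ℝ) * Torus.partialDeriv i (mikadoAmp k Λ g M N) x = 0 := by
  have hG : IsContDiff 1 (fun y : UnitAddTorus d => g (M • y)) :=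
    (isSmooth_comp_nsmul hg M).isContDiff (by exact_mod_cast le_top)
  have hP : IsContDiff 1 (shearPhase (d := d) k Λ) :=
    (isSmooth_shearPhase k Λ).isContDiff (by exact_mod_cast le_top)
  have hderiv : ∀ i, Torus.partialDeriv i (mikadoAmp k Λ g M N) x =
      ((N : ℝ) ^ 2)⁻¹ * (g (M • x) * Torus.partialDeriv i (shearPhase k Λ) x +
        Torus.partialDeriv i (fun y => g (M • y)) x * shearPhase k Λ x) := by
    intro i
    unfold mikadoAmp
    rw [partialDeriv_const_mul, partialDeriv_mul hG hP]
  simp_rw [hderiv]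
  have hsplit : ∑ i, (θ i : ℝ) * (((N : ℝ) ^ 2)⁻¹ * (g (M • x) * Torus.partialDeriv i (shearPhase k Λ) x +
      Torus.partialDeriv i (fun y => g (M • y)) x * shearPhase k Λ x)) =
      ((N : ℝ) ^ 2)⁻¹ * (g (M • x) * ∑ i, (θ i : ℝ) * Torus.partialDeriv i (shearPhase k Λ) x +
        shearPhase k Λ x * ∑ i, (θ i : ℝ) * Torus.partialDeriv i (fun y => g (M • y)) x) := by
    rw [Finset.mul_sum, Finset.mul_sum, ← Finset.sum_add_distrib, Finset.mul_sum]
    refine Finset.sum_congr rfl fun i _ => ?_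
    ring
  rw [hsplit, sum_mul_partialDeriv_shearPhase_eq_zero hθk,
    sum_mul_partialDeriv_comp_nsmul_eq_zero hθg, mul_zero, mul_zero, add_zero, mul_zero]

/-! ## Lemma 3.2 (2): steady pressureless Euler -/

/-- **Lemma 3.2 (2), first half: `div Ψ = 0`.** For `θ · k = 0` and a smooth profile with
`(θ·∇)g = 0`, the Mikado potential is divergence free: `div (A θ) = (θ·∇)A = 0`.
[cite: CoiculescuPalasek2025, Lemma 3.2 (2)] -/
theorem isDivFree_mikadoPotential {θ k : d → ℤ} (hθk : ∑ i, θ i * k i = 0) (Λ : ℂ)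
    {g : UnitAddTorus d → ℝ} (hg : Torus.IsSmooth g) (hθg : ∀ x, ∑ i, (θ i : ℝ) * Torus.partialDeriv i g x = 0)
    (M N : ℕ) : Torus.IsDivFree (mikadoPotential θ k Λ g M N) := by
  intro x
  unfold Torus.divergence
  have h : ∀ i, Torus.partialDeriv i (fun y => mikadoPotential θ k Λ g M N y i) x =
      (θ i : ℝ) * Torus.partialDeriv i (mikadoAmp k Λ g M N) x := by
    intro i
    have hfun : (fun y => mikadoPotential θ k Λ g M N y i) =
        fun y => mikadoAmp k Λ g M N y * (θ i : ℝ) := by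
      funext y
      simp [mikadoPotential_apply]
    rw [hfun, partialDeriv_mul_const, mul_comm]
  simp_rw [h]
  exact sum_mul_partialDeriv_mikadoAmp_eq_zero hθk Λ hg hθg M N x

/-- **Lemma 3.2 (2), second half: `(Ψ·∇)Ψ = 0`** (so that `div(Ψ ⊗ Ψ) = (Ψ·∇)Ψ + (div Ψ)Ψ = 0`: a
steady solution of the pressureless Euler equations). `D(Aθ)(x)[A(x)θ] = A(x) ((θ·∇)A)(x) θ = 0`.
[cite: CoiculescuPalasek2025, Lemma 3.2 (2)] -/
theorem convect_mikadoPotential_self {θ k : d → ℤ} (hθk : ∑ i, θ i * k i = 0) (Λ : ℂ)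
    {g : UnitAddTorus d → ℝ} (hg : Torus.IsSmooth g) (hθg : ∀ x, ∑ i, (θ i : ℝ) * Torus.partialDeriv i g x = 0)
    (M N : ℕ) (x : UnitAddTorus d) :
    Torus.convect (mikadoPotential θ k Λ g M N) (mikadoPotential θ k Λ g M N) x = 0 := by
  have hA : IsContDiff 1 (mikadoAmp (d := d) k Λ g M N) :=
    (isSmooth_mikadoAmp k Λ hg M N).isContDiff (by exact_mod_cast le_top)
  have hc : IsContDiff 1 (fun _ : UnitAddTorus d => dirVec θ) := contDiff_const
  unfold Torus.convect
  have h1 : Torus.fderiv (mikadoPotential θ k Λ g M N) x =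
      Torus.fderiv (fun y => mikadoAmp k Λ g M N y • dirVec θ) x := rfl
  rw [h1, fderiv_smul_apply hA hc, fderiv_const_apply, smul_zero, zero_add,
    mikadoPotential_apply, map_smul, fderiv_apply_eq_sum_partialDeriv hA]
  simp only [dirVec_apply, smul_eq_mul]
  rw [sum_mul_partialDeriv_mikadoAmp_eq_zero hθk Λ hg hθg M N x, mul_zero, zero_smul]

/-! ## Size -/

omit [DecidableEq d] in
/-- `|Re(Λ e_k(x))| ≤ ‖Λ‖` (`|e_k| = 1`). [folklore] -/
theorem abs_shearPhase_le (k : d → ℤ) (Λ : ℂ) (x : UnitAddTorus d) : |shearPhase k Λ x| ≤ ‖Λ‖ := by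
  unfold shearPhase
  refine (Complex.abs_re_le_norm _).trans ?_
  rw [norm_mul]
  have h : ‖mFourier k x‖ = 1 := by simp [mFourier]
  rw [h, mul_one]

omit [DecidableEq d] in
/-- **Lemma 3.2 (1), `m = 0`: the size of the potential** `‖Ψ(x)‖ ≤ N⁻² ‖Λ‖ |g(M • x)| ‖θ‖`
(in the paper `‖Ψ⁰_{j,k}‖_∞ ≲ N_k⁻²`). [cite: CoiculescuPalasek2025, Lemma 3.2 (1) (mikadoprofilebound)] -/
theorem norm_mikadoPotential_le (θ k : d → ℤ) (Λ : ℂ) (g : UnitAddTorus d → ℝ) (M N : ℕ)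
    (x : UnitAddTorus d) :
    ‖mikadoPotential θ k Λ g M N x‖ ≤ ((N : ℝ) ^ 2)⁻¹ * ‖Λ‖ * |g (M • x)| * ‖dirVec θ‖ := by
  rw [mikadoPotential_apply, norm_smul, Real.norm_eq_abs]
  refine mul_le_mul_of_nonneg_right ?_ (norm_nonneg _)
  unfold mikadoAmp
  rw [abs_mul, abs_mul, abs_inv, abs_of_nonneg (by positivity : (0 : ℝ) ≤ (N : ℝ) ^ 2)]
  have h := abs_shearPhase_le k Λ x
  have h0 : 0 ≤ ((N : ℝ) ^ 2)⁻¹ * |g (M • x)| := by positivity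
  calc ((N : ℝ) ^ 2)⁻¹ * (|g (M • x)| * |shearPhase k Λ x|)
      = ((N : ℝ) ^ 2)⁻¹ * |g (M • x)| * |shearPhase k Λ x| := by ring
    _ ≤ ((N : ℝ) ^ 2)⁻¹ * |g (M • x)| * ‖Λ‖ := mul_le_mul_of_nonneg_left h h0
    _ = ((N : ℝ) ^ 2)⁻¹ * ‖Λ‖ * |g (M • x)| := by ring

/-! ## The paper's directions: `θ = θ_j`, `k = N • η_j` -/

/-- `θ_j · (N η_j) = 0` for the Nash directions and normals of the paper. [cite: CoiculescuPalasek2025, §3.1] -/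
theorem nashDir_dot_nsmul_nashNormal (j : Fin 6) (N : ℕ) :
    ∑ i, nashDir j i * ((N : ℤ) • nashNormal j) i = 0 := by
  have h := nashDir_dot_nashNormal j
  simp only [Pi.smul_apply, smul_eq_mul]
  have h2 : ∑ i, nashDir j i * ((N : ℤ) * nashNormal j i) = (N : ℤ) * ∑ i, nashDir j i * nashNormal j i := by
    rw [Finset.mul_sum]
    refine Finset.sum_congr rfl fun i _ => ?_
    ring
  rw [h2, h, mul_zero]

/-- **Lemma 3.2 (2) for the paper's potentials, `div Ψ_{j,k} = 0`**: with `θ = θ_j`, `k = N_k η_j` and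
a smooth pipe profile constant along `θ_j`. [cite: CoiculescuPalasek2025, Lemma 3.2 (2)] -/
theorem isDivFree_mikadoPotential_nash (j : Fin 6) (N : ℕ) (Λ : ℂ)
    {g : UnitAddTorus (Fin 3) → ℝ} (hg : Torus.IsSmooth g)
    (hθg : ∀ x, ∑ i, (nashDir j i : ℝ) * Torus.partialDeriv i g x = 0) (M : ℕ) :
    Torus.IsDivFree (mikadoPotential (nashDir j) ((N : ℤ) • nashNormal j) Λ g M N) :=
  isDivFree_mikadoPotential (nashDir_dot_nsmul_nashNormal j N) Λ hg hθg M N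

/-- **Lemma 3.2 (2) for the paper's potentials, `(Ψ_{j,k}·∇)Ψ_{j,k} = 0`.**
[cite: CoiculescuPalasek2025, Lemma 3.2 (2)] -/
theorem convect_mikadoPotential_nash_self (j : Fin 6) (N : ℕ) (Λ : ℂ)
    {g : UnitAddTorus (Fin 3) → ℝ} (hg : Torus.IsSmooth g)
    (hθg : ∀ x, ∑ i, (nashDir j i : ℝ) * Torus.partialDeriv i g x = 0) (M : ℕ)
    (x : UnitAddTorus (Fin 3)) :
    Torus.convect (mikadoPotential (nashDir j) ((N : ℤ) • nashNormal j) Λ g M N)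
      (mikadoPotential (nashDir j) ((N : ℤ) • nashNormal j) Λ g M N) x = 0 :=
  convect_mikadoPotential_self (nashDir_dot_nsmul_nashNormal j N) Λ hg hθg M N x

end CP25

end Literature.Analysis.FluidPDE
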